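import Summits.QuantumFields.BalabanUV.T4Continuum.Support.ActivityTermSlot
import Literature.MathematicalPhysics.QuantumFieldTheory.Balaban1983to89.T4ActivityThreshold

/-!
# NE5 / U3, the wall `ActivityLipschitz₂` made a theorem for the term model — part 3 of 3: THE TERM MODEL, its
# `ActivityLipschitz₂` and `BaseMajorant` as THEOREMS, and the route's closure with both DISCHARGED

See part 1 (`ActivityTermDatum`) for the framing, the dictionary and the status of every hypothesis (cell `pub-balaban`,
unit `b2b-balaban-t4-ne5-p2-g15`; Summits-side new work; rung (B)+1 finite T⁴ — NOT infinite volume, NOT mass gap, NOT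
Clay, NOT a proof of NE5).  `TermFamily` = which terms are present in each activity (finite), each term's datum and
constants over common carriers, the two runs' input maps and the margins; `TermFamily.model : InputModel` has activities
`Ψ g U X γ = Σ_{i ∈ terms} term_i` and admissible class `Base g U X` = "reference data `RefAt` for every term of every
activity of the step volume of `X`" (printed KIND for one run).  THEOREMS: `activityLipschitz₂_model` — for a well-formed
family (`Admissible`, `Geometry`, `ReadLip` at the model's margins, every term), moduli `Λop, Λhist > 0`, reach `ρ₀ ≤ 1`
and a one-run majorant with `Σ_i G_i ≤ m g U γ` (`G_i = size_i + ampOp_i/Λop + ampHist_i/Λhist`), the model satisfies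
`InputModel.ActivityLipschitz₂ W m Λop Λhist ρ₀` BY NAME (via `T4ActivityThreshold.activityLipschitz₂_of_termSlots`);
`baseMajorant_model` — the same majorant gives `BaseMajorant W m`; `ne5_at_max_of_model_reach` /
`ne5_above_max_of_model_reach` — `T4ActivityThreshold.ne5_at_max_of_model_actLip₂_reach` (resp. `…above…`) with `hlip`
and `hmaj` DISCHARGED, every other input BY NAME and unchanged: NOT PRINTED `Represents`/`Realizes` (MI-R),
`OperatorRate`, `InsertionRate`, `InsScaleBound` (siblings), the numeric census (R1)–(R3) + off-resonance; PRINTED KIND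
`InBase`, `KPInflated`, `DecayExtract`, `PinBudget`, `DecayBound` ×2, `InsAffine`/`InsBlind`/`InsHomog`, well-formedness
and majorant domination.  `read_of_clm`: the history read-out clauses of `ReadLip` hold by construction for bounded-linear
read-outs (printed STRUCTURE (1.23) p. 7, (1.33) p. 9 of [Balaban1988RG2Cluster]).  No `sorry`, no new axioms.
-/

open MeasureTheory
open scoped BigOperators

namespace Summit.QuantumFields.BalabanUV.T4Continuum.ActivityTermModel


open Literature.MathematicalPhysics.QuantumFieldTheory.Balaban1983to89.T4ActivityTilt
  (diffForm domForm domForm_nonneg sandwichKer mulKer sqrtKer lorentz)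
open Literature.MathematicalPhysics.QuantumFieldTheory.Balaban1983to89.T4ActivityTilt renaming resolvent → kerResolvent
open Literature.MathematicalPhysics.QuantumFieldTheory.Balaban1983to89.T4ActivityTiltPotential (potSum potSum_sub)
open Literature.MathematicalPhysics.QuantumFieldTheory.Balaban1983to89.T4ActivityTiltHistory
  (histPot histPot_sub ReadAdditive ReadUnitBound read_sub_of_additive norm_histPot_read_sub_le)
open Literature.MathematicalPhysics.QuantumFieldTheory.Balaban1983to89.T4ActivityTermReach (termSlot_of_reach)

variable {Op Hist ι κ S Ω Ω₀ 𝒴 𝒞 : Type*} [Fintype ι] [Fintype κ] [MeasurableSpace Ω] [MeasurableSpace Ω₀]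

/-! ## §(e) THE TERM MODEL: an `InputModel` whose activities are finite sums of terms and whose admissible class is
## "reference data for every term"; its `ActivityLipschitz₂` and `BaseMajorant` are THEOREMS -/

section Model

open Literature.MathematicalPhysics.QuantumFieldTheory.Balaban1983to89.T4OutputRate (Carriers Functional DecayBound NE5)
open Literature.MathematicalPhysics.QuantumFieldTheory.Balaban1983to89.T4ActivityLipschitz (ClusterRep)
open Literature.MathematicalPhysics.QuantumFieldTheory.Balaban1983to89.T4ActivityRecursion (InputModel relDisc KPInflated)
open Literature.MathematicalPhysics.QuantumFieldTheory.Balaban1983to89.T4ActivityThreshold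
  (activityLipschitz₂_of_termSlots ne5_at_max_of_model_actLip₂_reach ne5_above_max_of_model_actLip₂_reach)

variable {C : Carriers} {R : ClusterRep C} [NormedAddCommGroup Op] [NormedSpace ℂ Op] [NormedAddCommGroup Hist]
  [NormedSpace ℂ Hist] {J : Type*}

/-- THE TERM FAMILY of an activity model: which terms are present in `ρ(γ)` (`terms`, finite), each term's datum and
constants (over common carriers: one lattice, the localisation being by the finsets `D`, `cubes`, …). [folklore] -/
structure TermFamily (R : ClusterRep C) (Op Hist ι κ S Ω Ω₀ 𝒴 𝒞 : Type*) [Fintype ι] [Fintype κ] [MeasurableSpace Ω]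
    [MeasurableSpace Ω₀] (J : Type*) where
  /-- the terms present in the activity of `γ` in the step volume of `X` -/
  terms : (ℕ → ℝ) → C.BgB → C.Dom → R.P → Finset J
  /-- the datum of term `i` -/
  𝔱 : (ℕ → ℝ) → C.BgB → C.Dom → R.P → J → TermDatum Op Hist ι κ S Ω Ω₀ 𝒴 𝒞
  /-- the constants of term `i` -/
  𝔠 : (ℕ → ℝ) → C.BgB → C.Dom → R.P → J → TermConsts
  /-- run A's operator input at `X` -/
  opA : (ℕ → ℝ) → C.BgB → C.Dom → Op
  /-- run B's operator input at `X` -/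
  opB : (ℕ → ℝ) → C.BgB → C.Dom → Op
  /-- run A's history insertion at `X` -/
  insA : (ℕ → ℝ) → C.BgB → C.Dom → (C.Dom → ℝ) → Hist
  /-- run B's history insertion at `X` -/
  insB : (ℕ → ℝ) → C.BgB → C.Dom → (C.Dom → ℝ) → Hist
  /-- operator margin at `X` -/
  ϱOp : C.Dom → ℝ
  /-- history margin at `X` -/
  ϱHist : C.Dom → ℝ
  ϱOp_pos : ∀ X, 0 < ϱOp X
  ϱHist_pos : ∀ X, 0 < ϱHist X

namespace TermFamily

variable [DecidableEq ι] [DecidableEq κ] [DecidableEq 𝒞] (𝔉 : TermFamily R Op Hist ι κ S Ω Ω₀ 𝒴 𝒞 J)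

/-- THE TERM MODEL: activities = finite sums of terms; admissible class at `X` = the input points carrying reference data
for every term of every activity of the step volume of `X`. [folklore] -/
noncomputable def model : InputModel R Op Hist where
  Ψ g U X γ pt := ∑ i ∈ 𝔉.terms g U X γ, (𝔉.𝔱 g U X γ i).term pt
  opA := 𝔉.opA
  opB := 𝔉.opB
  insA := 𝔉.insA
  insB := 𝔉.insB
  Base g U X := {pt | ∀ γ ∈ R.vol X, ∀ i ∈ 𝔉.terms g U X γ, (𝔉.𝔱 g U X γ i).RefAt (𝔉.𝔠 g U X γ i) pt}
  ϱOp := 𝔉.ϱOp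
  ϱHist := 𝔉.ϱHist
  ϱOp_pos := 𝔉.ϱOp_pos
  ϱHist_pos := 𝔉.ϱHist_pos

/-- The per-term majorant of the junction: size + the two amplitudes in units of the moduli. [folklore] -/
noncomputable def G (Λop Λhist ρ₀ : ℝ) (g : ℕ → ℝ) (U : C.BgB) (X : C.Dom) (γ : R.P) (i : J) : ℝ :=
  (𝔉.𝔠 g U X γ i).size + (𝔉.𝔱 g U X γ i).ampOp (𝔉.𝔠 g U X γ i) ρ₀ / Λop
    + (𝔉.𝔱 g U X γ i).ampHist (𝔉.𝔠 g U X γ i) ρ₀ / Λhist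

/-- HYPOTHESIS SHAPE (the term family is WELL-FORMED on the window: admissible constants, one-run geometry and read-out
Lipschitz structure at the model's margins, for every term; asserted nowhere). [folklore] -/
@[folklore]
structure WellFormed (W : Set (ℕ → ℝ)) : Prop where
  hadm : ∀ g ∈ W, ∀ (U : C.BgB) (X : C.Dom), ∀ γ ∈ R.vol X, ∀ i ∈ 𝔉.terms g U X γ, (𝔉.𝔠 g U X γ i).Admissible
  hgeo : ∀ g ∈ W, ∀ (U : C.BgB) (X : C.Dom), ∀ γ ∈ R.vol X, ∀ i ∈ 𝔉.terms g U X γ,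
    (𝔉.𝔱 g U X γ i).Geometry (𝔉.𝔠 g U X γ i)
  hlip : ∀ g ∈ W, ∀ (U : C.BgB) (X : C.Dom), ∀ γ ∈ R.vol X, ∀ i ∈ 𝔉.terms g U X γ,
    (𝔉.𝔱 g U X γ i).ReadLip (𝔉.𝔠 g U X γ i) (𝔉.ϱOp X) (𝔉.ϱHist X)

/-- [folklore] **`ActivityLipschitz₂` OF THE TERM MODEL IS A THEOREM.**  For a well-formed term family, any moduli
`Λop, Λhist > 0`, any reach `0 ≤ ρ₀ ≤ 1` and any one-run majorant `m` dominating the per-term majorants `Σ_i G_i ≤ m g U γ`,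
the model satisfies `ActivityLipschitz₂ W m Λop Λhist ρ₀` — the route's located wall G-ne5p2-3′, BY NAME, with nothing
assumed at the displaced input point. -/
theorem activityLipschitz₂_model {W : Set (ℕ → ℝ)}
    {m : (ℕ → ℝ) → C.BgB → R.P → ℝ} {Λop Λhist ρ₀ : ℝ} (hwf : 𝔉.WellFormed W) (hΛop : 0 < Λop) (hΛhist : 0 < Λhist)
    (hρ₁ : ρ₀ ≤ 1)
    (hsum : ∀ g ∈ W, ∀ (U : C.BgB) (X : C.Dom), ∀ γ ∈ R.vol X, ∑ i ∈ 𝔉.terms g U X γ, 𝔉.G Λop Λhist ρ₀ g U X γ i ≤ m g U γ) :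
    𝔉.model.ActivityLipschitz₂ W m Λop Λhist ρ₀ := by
  refine activityLipschitz₂_of_termSlots 𝔉.model 𝔉.terms (fun g U X γ i => (𝔉.𝔱 g U X γ i).term) (𝔉.G Λop Λhist ρ₀)
    (fun g _ U X γ _ q => rfl) (fun g hg U X p hp q hq γ hγ i hi => ?_) hsum hΛop.le hΛhist.le
  show _ ≤ (Λop * (‖q.1 - p.1‖ / 𝔉.ϱOp X) + Λhist * (‖q.2 - p.2‖ / 𝔉.ϱHist X)) * 𝔉.G Λop Λhist ρ₀ g U X γ i
  have hδop0 : 0 ≤ ‖q.1 - p.1‖ / 𝔉.ϱOp X := div_nonneg (norm_nonneg _) (𝔉.ϱOp_pos X).le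
  have hδh0 : 0 ≤ ‖q.2 - p.2‖ / 𝔉.ϱHist X := div_nonneg (norm_nonneg _) (𝔉.ϱHist_pos X).le
  have hq' : ‖q.1 - p.1‖ / 𝔉.ϱOp X + ‖q.2 - p.2‖ / 𝔉.ϱHist X ≤ ρ₀ := hq
  have h := (𝔉.𝔱 g U X γ i).norm_term_sub_le (𝔉.𝔠 g U X γ i) (ρ₀ := ρ₀) (𝔉.ϱOp_pos X) (𝔉.ϱHist_pos X)
    (hwf.hadm g hg U X γ hγ i hi) (hwf.hgeo g hg U X γ hγ i hi) (hwf.hlip g hg U X γ hγ i hi) (hp γ hγ i hi) q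
    (by linarith) (by linarith)
  obtain ⟨hAop, hAh, hsz⟩ := (𝔉.𝔱 g U X γ i).amp_nonneg (𝔉.𝔠 g U X γ i) (hwf.hadm g hg U X γ hγ i hi) ρ₀
  refine h.trans ?_
  have hG1 : (𝔉.𝔱 g U X γ i).ampOp (𝔉.𝔠 g U X γ i) ρ₀ ≤ Λop * 𝔉.G Λop Λhist ρ₀ g U X γ i := by
    unfold G
    rw [mul_add, mul_add, mul_div_cancel₀ _ hΛop.ne']
    nlinarith [div_nonneg hAh hΛhist.le]
  have hG2 : (𝔉.𝔱 g U X γ i).ampHist (𝔉.𝔠 g U X γ i) ρ₀ ≤ Λhist * 𝔉.G Λop Λhist ρ₀ g U X γ i := by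
    unfold G
    rw [mul_add, mul_add, mul_div_cancel₀ _ hΛhist.ne']
    nlinarith [div_nonneg hAop hΛop.le]
  calc (𝔉.𝔱 g U X γ i).ampOp (𝔉.𝔠 g U X γ i) ρ₀ * (‖q.1 - p.1‖ / 𝔉.ϱOp X)
        + (𝔉.𝔱 g U X γ i).ampHist (𝔉.𝔠 g U X γ i) ρ₀ * (‖q.2 - p.2‖ / 𝔉.ϱHist X)
      ≤ Λop * 𝔉.G Λop Λhist ρ₀ g U X γ i * (‖q.1 - p.1‖ / 𝔉.ϱOp X)
        + Λhist * 𝔉.G Λop Λhist ρ₀ g U X γ i * (‖q.2 - p.2‖ / 𝔉.ϱHist X) :=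
        add_le_add (mul_le_mul_of_nonneg_right hG1 hδop0) (mul_le_mul_of_nonneg_right hG2 hδh0)
    _ = (Λop * (‖q.1 - p.1‖ / 𝔉.ϱOp X) + Λhist * (‖q.2 - p.2‖ / 𝔉.ϱHist X)) * 𝔉.G Λop Λhist ρ₀ g U X γ i := by
        ring

/-- [folklore] **`BaseMajorant` OF THE TERM MODEL IS A THEOREM** (same majorant: the sizes are part of `G`). -/
theorem baseMajorant_model {W : Set (ℕ → ℝ)}
    {m : (ℕ → ℝ) → C.BgB → R.P → ℝ} {Λop Λhist ρ₀ : ℝ} (hwf : 𝔉.WellFormed W) (hΛop : 0 < Λop) (hΛhist : 0 < Λhist)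
    (hsum : ∀ g ∈ W, ∀ (U : C.BgB) (X : C.Dom), ∀ γ ∈ R.vol X, ∑ i ∈ 𝔉.terms g U X γ, 𝔉.G Λop Λhist ρ₀ g U X γ i ≤ m g U γ) :
    𝔉.model.BaseMajorant W m := by
  intro g hg U X p hp γ hγ
  show ‖∑ i ∈ 𝔉.terms g U X γ, (𝔉.𝔱 g U X γ i).term p‖ ≤ m g U γ
  refine (norm_sum_le _ _).trans (le_trans (Finset.sum_le_sum fun i hi => ?_) (hsum g hg U X γ hγ))
  obtain ⟨hAop, hAh, -⟩ := (𝔉.𝔱 g U X γ i).amp_nonneg (𝔉.𝔠 g U X γ i) (hwf.hadm g hg U X γ hγ i hi) ρ₀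
  have := (𝔉.𝔱 g U X γ i).norm_term_le (𝔉.𝔠 g U X γ i) (hwf.hadm g hg U X γ hγ i hi) (hp γ hγ i hi)
  unfold G
  have := div_nonneg hAop hΛop.le
  have := div_nonneg hAh hΛhist.le
  linarith

/-- [folklore] **THE ROUTE'S CLOSURE FOR THE TERM MODEL** (`T4ActivityThreshold.ne5_at_max_of_model_actLip₂_reach` with its
two hypotheses `ActivityLipschitz₂` and `BaseMajorant` DISCHARGED by the theorems above; every other input BY NAME and
unchanged).  Remaining NOT-PRINTED inputs, by name: `Represents`/`Realizes` (two-run bookkeeping, cell MI-R), `OperatorRate`,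
`InsertionRate`, `InsScaleBound` (the two-run RATES; siblings' currency), the numeric census (R1)–(R3) + off-resonance;
PRINTED-KIND one-run inputs: `InBase` (reference data at run B's own input), `KPInflated`, `DecayExtract`, `PinBudget`,
`DecayBound`×2, the insertion structure `InsAffine`/`InsBlind`/`InsHomog`, and the well-formedness + majorant domination of
the term family. -/
theorem ne5_at_max_of_model_reach {EA : Functional C C.BgA}
    {EB : Functional C C.BgB} {W : Set (ℕ → ℝ)} {m : (ℕ → ℝ) → C.BgB → R.P → ℝ} {a d : R.P → ℝ} {δX : C.Dom → ℝ}
    {A A₀ E₀ E₁ κ θ δ δ' c ω s Λop Λhist ρ₀ ρ₀' : ℝ}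
    (hwf : 𝔉.WellFormed W)
    (hsum : ∀ g ∈ W, ∀ (U : C.BgB) (X : C.Dom), ∀ γ ∈ R.vol X, ∑ i ∈ 𝔉.terms g U X γ, 𝔉.G Λop Λhist ρ₀ g U X γ i ≤ m g U γ)
    (hρ₁ : ρ₀ ≤ 1)
    (hrep : R.Represents EA EB) (hreal : 𝔉.model.Realizes EA EB W) (hbase : 𝔉.model.InBase EB W)
    (hKP : KPInflated R W m s a d) (hdec : R.DecayExtract δX d) (hpin : R.PinBudget a δX A κ)
    (hdA : DecayBound EA W A₀ κ) (hdB : DecayBound EB W E₀ κ)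
    (hop : 𝔉.model.OperatorRate W δ θ) (hins : 𝔉.model.InsertionRate W κ E₀ δ' θ)
    (haff : 𝔉.model.InsAffine W) (hblind : 𝔉.model.InsBlind W) (hhom : 𝔉.model.InsHomog W)
    (hunit : 𝔉.model.InsScaleBound W κ E₁ c ω)
    (hE₁ : 0 < E₁) (hA : 0 ≤ A) (hΛop : 0 < Λop) (hΛhist : 0 < Λhist) (hρ : max (Λhist / Λop) 1 * ρ₀' ≤ ρ₀)
    (hs : Λhist * ρ₀' < s) (hδ : 0 ≤ δ) (hδ' : 0 ≤ δ') (hθ : 0 ≤ θ) (hθ1 : θ < 1)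
    (hc : 0 ≤ c) (hω : 0 < ω) (hω1 : ω < 1) (hreach : c * (A₀ + E₀) / (1 - ω) < ρ₀')
    (hres : θ ≠ ω + A * Λhist / (s - Λhist * ρ₀') * c) :
    ∃ C₅, NE5 EA EB W κ (max θ (ω + A * Λhist / (s - Λhist * ρ₀') * c)) C₅ :=
  ne5_at_max_of_model_actLip₂_reach 𝔉.model hrep hreal hbase (𝔉.baseMajorant_model hwf hΛop hΛhist hsum) hKP
    (𝔉.activityLipschitz₂_model hwf hΛop hΛhist hρ₁ hsum) hdec hpin hdA hdB hop hins haff hblind hhom hunit hE₁ hA hΛop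
    hΛhist hρ hs hδ hδ' hθ hθ1 hc hω hω1 hreach hres

/-- [folklore] **… and every rate strictly above `max(θ, r)`, resonance included** (same discharge in
`T4ActivityThreshold.ne5_above_max_of_model_actLip₂_reach`). -/
theorem ne5_above_max_of_model_reach {EA : Functional C C.BgA}
    {EB : Functional C C.BgB} {W : Set (ℕ → ℝ)} {m : (ℕ → ℝ) → C.BgB → R.P → ℝ} {a d : R.P → ℝ} {δX : C.Dom → ℝ}
    {A A₀ E₀ E₁ κ θ δ δ' c ω s Λop Λhist ρ₀ ρ₀' : ℝ}
    (hwf : 𝔉.WellFormed W)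
    (hsum : ∀ g ∈ W, ∀ (U : C.BgB) (X : C.Dom), ∀ γ ∈ R.vol X, ∑ i ∈ 𝔉.terms g U X γ, 𝔉.G Λop Λhist ρ₀ g U X γ i ≤ m g U γ)
    (hρ₁ : ρ₀ ≤ 1)
    (hrep : R.Represents EA EB) (hreal : 𝔉.model.Realizes EA EB W) (hbase : 𝔉.model.InBase EB W)
    (hKP : KPInflated R W m s a d) (hdec : R.DecayExtract δX d) (hpin : R.PinBudget a δX A κ)
    (hdA : DecayBound EA W A₀ κ) (hdB : DecayBound EB W E₀ κ)
    (hop : 𝔉.model.OperatorRate W δ θ) (hins : 𝔉.model.InsertionRate W κ E₀ δ' θ)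
    (haff : 𝔉.model.InsAffine W) (hblind : 𝔉.model.InsBlind W) (hhom : 𝔉.model.InsHomog W)
    (hunit : 𝔉.model.InsScaleBound W κ E₁ c ω)
    (hE₁ : 0 < E₁) (hA : 0 ≤ A) (hΛop : 0 < Λop) (hΛhist : 0 < Λhist) (hρ : max (Λhist / Λop) 1 * ρ₀' ≤ ρ₀)
    (hs : Λhist * ρ₀' < s) (hδ : 0 ≤ δ) (hδ' : 0 ≤ δ') (hθ : 0 ≤ θ) (hθ1 : θ < 1)
    (hc : 0 ≤ c) (hω : 0 < ω) (hω1 : ω < 1) (hreach : c * (A₀ + E₀) / (1 - ω) < ρ₀')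
    {θ' : ℝ} (hθ' : max θ (ω + A * Λhist / (s - Λhist * ρ₀') * c) < θ') :
    ∃ C₅, NE5 EA EB W κ θ' C₅ :=
  ne5_above_max_of_model_actLip₂_reach 𝔉.model hrep hreal hbase (𝔉.baseMajorant_model hwf hΛop hΛhist hsum) hKP
    (𝔉.activityLipschitz₂_model hwf hΛop hΛhist hρ₁ hsum) hdec hpin hdA hdB hop hins haff hblind hhom hunit hE₁ hA hΛop
    hΛhist hρ hs hδ hδ' hθ hθ1 hc hω hω1 hreach hθ'

end TermFamily

/-! ## §(f) The history read-out clauses hold BY CONSTRUCTION for bounded-linear read-outs (printed STRUCTURE: the earlier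
## actions enter the localized potentials linearly, (1.23) p. 7 and (1.33) p. 9 of [Balaban1988RG2Cluster]) -/

/-- [folklore] A read-out that is a bounded linear functional of the history datum at every `(Y, x)`, with operator norms
in the `v(Y)/ϱ` format against the weights `τ`, is `ReadAdditive` and obeys `ReadUnitBound … ϱ`. -/
theorem read_of_clm {𝒴' Ω' : Type*} (L : 𝒴' → Ω' → (Hist →L[ℂ] ℂ)) (D : Finset 𝒴') (τ : 𝒴' → ℂ) (v : 𝒴' → ℝ)
    {ϱ : ℝ} (hϱ : 0 < ϱ) (hL : ∀ Y ∈ D, ∀ x, ‖τ Y‖ * ‖L Y x‖ ≤ v Y / ϱ) :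
    ReadAdditive (fun (h : Hist) Y x => L Y x h) ∧ ReadUnitBound (fun (h : Hist) Y x => L Y x h) D τ v ϱ := by
  refine ⟨fun h h' Y x => map_add (L Y x) h h', fun h Y hY x => ?_⟩
  calc ‖τ Y * L Y x h‖ = ‖τ Y‖ * ‖L Y x h‖ := norm_mul _ _
    _ ≤ ‖τ Y‖ * (‖L Y x‖ * ‖h‖) := mul_le_mul_of_nonneg_left ((L Y x).le_opNorm h) (norm_nonneg _)
    _ = ‖τ Y‖ * ‖L Y x‖ * ‖h‖ := by ring
    _ ≤ v Y / ϱ * ‖h‖ := mul_le_mul_of_nonneg_right (hL Y hY x) (norm_nonneg _)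
    _ = ‖h‖ / ϱ * v Y := by field_simp

end Model

end Summit.QuantumFields.BalabanUV.T4Continuum.ActivityTermModel
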